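import Summits.ResolutionOfSingularities.ResolutionOfSingularities.Theorems.FrobeniusClosingPatchingRelPerfectDepthPhaseCX3Defs
import Summits.ResolutionOfSingularities.ResolutionOfSingularities.Theorems.FrobeniusClosingPatchingRelPerfectMonomialSumLocalPair
import Literature.AlgebraicGeometry.Resolution.BlowupRestrictOpen
import HarnessLib

/-!
# Crux `PatchingRelPerfect` (stmt-ResolutionOfSingularities-16161), chain W5.2 — F7(β) (β-AX) X3 C-I: LOCAL END TRANSPORTS ALONG OPEN
# IMMERSIONS (both directions)

[OURS · L1 W5.2 · res-L1-w52-plan-1 RULING G12-49 (1) (the pieces bridge `goodEnd_of_closedPieces`, hand res-L1-w52-lead-1 g6) — part 1.]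
Replaces the role of NO printed item; NOT a statement of the manuscript under review (AI-written; AI review weaker than expert review; counted 0).
Def-free.  The two transports every globalisation step uses (the (β′) bridge …DepthPhaseCOnePieces, the (G-P)/(G-A) hands, the cure
assembly): for an OPEN IMMERSION `g : Y ⟶ X` (X locally Noetherian),

* PULL `IsMonomialNear.comap_of_isOpenImmersion` / `IsEndNear.comap_of_isOpenImmersion` — a local END presentation of `K` at `g y` pulls
  back to one of `g^* K` at `y` with the pulled-back letters (`HasSNCWith.comap_of_isOpenImmersion` on the presentation open,
  `DepthTargets.comap_monomialSum_eq_map`);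
* PUSH `IsMonomialNear.of_comap_isOpenImmersion` / `IsEndNear.of_comap_isOpenImmersion` — a local END presentation of `g^* K` at `y` pushes
  forward to one of `K` at `g y`, the letters extended along `g` by `Scheme.IdealSheafData.map` (`(F.map g).comap g = F`,
  `CentreSeqExtend.comap_map_of_isOpenImmersion`; the presentation open is the image `g ''ᵁ U`, identified with `U` by `Scheme.Hom.isoImage`).

## References
* E. Bierstone, D. Grigoriev, P. Milman, J. Włodarczyk, arXiv:1206.3090, Thm. 8.0.5 with Def. 3.1.3 (2). [BierstoneGrigorievMilmanWlodarczyk2011]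
* U. Görtz, T. Wedhorn, *Algebraic Geometry I* (2nd ed. 2020), Prop. 13.91. [GortzWedhorn2020]
-/

-- `Summit.<Summit>.<Sub>.Theorems` with `Sub = Summit` (single-conjunct summit, D-0017)
set_option linter.dupNamespace false

noncomputable section

namespace Summit.ResolutionOfSingularities.ResolutionOfSingularities.Theorems.X3LemmaM

open CategoryTheory AlgebraicGeometry TopologicalSpace IsLocalRing
open Literature.AlgebraicGeometry.Resolution
open Scheme.IdealSheafData

universe u

variable {X Y : Scheme.{u}}

/-! ## §1 List bookkeeping -/

/-- Members of rows transformed letter-wise. [folklore] -/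
theorem boundaryOf_map_map (A : List (Y.IdealSheafData × ℕ)) (g : Y ⟶ X) :
    boundaryOf (A.map fun p => (p.1.map g, p.2)) = (boundaryOf A).map (·.map g) := by
  simp only [boundaryOf, List.map_map]
  rfl

/-- Pulling back a list of letters along a composite. [folklore] -/
theorem map_comap_comp {Z : Scheme.{u}} (Λ : List X.IdealSheafData) (f : Y ⟶ X) (h : Z ⟶ Y) :
    (Λ.map (·.comap f)).map (·.comap h) = Λ.map (·.comap (h ≫ f)) := by
  rw [List.map_map]
  congr 1
  funext F
  exact (Scheme.IdealSheafData.comap_comp F h f).symm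

/-- Pulling back rows along a composite. [folklore] -/
theorem map_rows_comap_comp {Z : Scheme.{u}} (𝒦 : List (List (X.IdealSheafData × ℕ))) (f : Y ⟶ X) (h : Z ⟶ Y) :
    (𝒦.map fun A => (A.map fun p => (p.1.comap f, p.2)).map fun p => (p.1.comap h, p.2)) =
      𝒦.map fun A => A.map fun p => (p.1.comap (h ≫ f), p.2) := by
  congr 1
  funext A
  rw [List.map_map]
  congr 1
  funext p
  exact Prod.ext (Scheme.IdealSheafData.comap_comp p.1 h f).symm rfl

/-! ## §2 PULL: along an open immersion -/

/-- [OURS · L1 W5.2] **A local monomial presentation pulls back along an open immersion** (presentation open `g⁻¹U`, letters `g^* Λ`).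
[cite: BierstoneGrigorievMilmanWlodarczyk2011, Thm. 8.0.5 with Def. 3.1.3 (2)] -/
theorem IsMonomialNear.comap_of_isOpenImmersion [IsLocallyNoetherian X] (g : Y ⟶ X) [IsOpenImmersion g] {K : X.IdealSheafData}
    {Λ : List X.IdealSheafData} {y : Y} (h : IsMonomialNear K Λ (g y)) :
    IsMonomialNear (K.comap g) (Λ.map (·.comap g)) y := by
  obtain ⟨U, hxU, hsnc, 𝒦, hbd, hne, hK⟩ := h
  haveI : IsLocallyNoetherian (U : Scheme.{u}) := isLocallyNoetherian_of_isOpenImmersion U.ι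
  have hfac : (g ∣_ U) ≫ U.ι = (g ⁻¹ᵁ U).ι ≫ g := morphismRestrict_ι g U
  refine ⟨g ⁻¹ᵁ U, hxU, ?_, 𝒦.map (fun A => A.map fun p => (p.1.comap g, p.2)), ?_, by simpa using hne, ?_⟩
  · have h1 := hsnc.comap_of_isOpenImmersion (f := g ∣_ U)
    rw [Scheme.IdealSheafData.comap_top, map_comap_comp, hfac, ← map_comap_comp] at h1
    exact h1
  · intro L hL
    obtain ⟨A, hA, rfl⟩ := List.mem_map.mp hL
    rw [DepthTargets.boundaryOf_map_comap, hbd A hA]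
  · rw [← Scheme.IdealSheafData.comap_comp, ← hfac, Scheme.IdealSheafData.comap_comp, hK, ← Scheme.IdealSheafData.comap_comp, hfac,
      Scheme.IdealSheafData.comap_comp, DepthTargets.comap_monomialSum_eq_map]

/-- [OURS · L1 W5.2] **Local END pulls back along an open immersion.** [cite: BierstoneGrigorievMilmanWlodarczyk2011, Thm. 8.0.5] -/
theorem IsEndNear.comap_of_isOpenImmersion [IsLocallyNoetherian X] (g : Y ⟶ X) [IsOpenImmersion g] {K : X.IdealSheafData}
    {𝓛 : List X.IdealSheafData} {y : Y} (h : IsEndNear K 𝓛 (g y)) : IsEndNear (K.comap g) (𝓛.map (·.comap g)) y := by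
  obtain ⟨Λ, hΛ, hmono⟩ := h
  refine ⟨Λ.map (·.comap g), fun F hF => ?_, hmono.comap_of_isOpenImmersion g⟩
  obtain ⟨F₀, hF₀, rfl⟩ := List.mem_map.mp hF
  exact List.mem_map.mpr ⟨F₀, hΛ F₀ hF₀, rfl⟩

/-! ## §3 PUSH: along an open immersion -/

/-- [OURS · L1 W5.2] **A local monomial presentation of `g^* K` pushes forward along the open immersion `g`**: presentation open `g(U)`,
letters extended by `Scheme.IdealSheafData.map g`. [cite: GortzWedhorn2020, Prop. 13.91] -/
theorem IsMonomialNear.of_comap_isOpenImmersion [IsLocallyNoetherian X] (g : Y ⟶ X) [IsOpenImmersion g] [QuasiCompact g]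
    {K : X.IdealSheafData} {Λ' : List Y.IdealSheafData} {y : Y} (h : IsMonomialNear (K.comap g) Λ' y) :
    IsMonomialNear K (Λ'.map (·.map g)) (g y) := by
  obtain ⟨U', hyU, hsnc, 𝒦', hbd, hne, hK⟩ := h
  haveI : IsLocallyNoetherian Y := isLocallyNoetherian_of_isOpenImmersion g
  haveI : IsLocallyNoetherian (U' : Scheme.{u}) := isLocallyNoetherian_of_isOpenImmersion U'.ι
  set e := g.isoImage U' with he
  have hι : (g ''ᵁ U').ι = e.inv ≫ U'.ι ≫ g := (Scheme.Hom.isoImage_inv_ι g U').symm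
  -- every extended letter restricts along `e.inv ≫ U'.ι ≫ g` to the pulled-back letter
  have hletter : ∀ F' : Y.IdealSheafData, (F'.map g).comap (g ''ᵁ U').ι = (F'.comap U'.ι).comap e.inv := fun F' => by
    rw [hι, Scheme.IdealSheafData.comap_comp, Scheme.IdealSheafData.comap_comp, CentreSeqExtend.comap_map_of_isOpenImmersion]
  have hfun : (fun F' : Y.IdealSheafData => (F'.map g).comap (g ''ᵁ U').ι) = fun F' => (F'.comap U'.ι).comap e.inv :=
    funext hletter
  have hrows : ((𝒦'.map fun A => A.map fun p => (p.1.map g, p.2)).map fun A => A.map fun p => (p.1.comap g, p.2)) = 𝒦' := by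
    rw [List.map_map]
    conv_rhs => rw [← List.map_id 𝒦']
    congr 1
    funext A
    simp [List.map_map, Function.comp_def, CentreSeqExtend.comap_map_of_isOpenImmersion]
  refine ⟨g ''ᵁ U', ⟨y, hyU, rfl⟩, ?_, 𝒦'.map (fun A => A.map fun p => (p.1.map g, p.2)), ?_, by simpa using hne, ?_⟩
  · -- snc on `g(U')`: pull the presentation on `U'` back along the isomorphism `e.inv`
    have h1 := hsnc.comap_of_isOpenImmersion (f := e.inv)
    rw [Scheme.IdealSheafData.comap_top, List.map_map, Function.comp_def] at h1
    rw [List.map_map, Function.comp_def, hfun]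
    exact h1
  · intro L hL
    obtain ⟨A, hA, rfl⟩ := List.mem_map.mp hL
    rw [boundaryOf_map_map, hbd A hA]
  · rw [hι]
    simp only [Scheme.IdealSheafData.comap_comp]
    rw [hK, DepthTargets.comap_monomialSum_eq_map _ g, hrows]

/-- [OURS · L1 W5.2] **Local END of `g^* K` pushes forward along the open immersion `g`.** [cite: GortzWedhorn2020, Prop. 13.91] -/
theorem IsEndNear.of_comap_isOpenImmersion [IsLocallyNoetherian X] (g : Y ⟶ X) [IsOpenImmersion g] [QuasiCompact g]
    {K : X.IdealSheafData} {𝓛' : List Y.IdealSheafData} {y : Y} (h : IsEndNear (K.comap g) 𝓛' y) :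
    IsEndNear K (𝓛'.map (·.map g)) (g y) := by
  obtain ⟨Λ', hΛ, hmono⟩ := h
  refine ⟨Λ'.map (·.map g), fun F hF => ?_, hmono.of_comap_isOpenImmersion g⟩
  obtain ⟨F₀, hF₀, rfl⟩ := List.mem_map.mp hF
  exact List.mem_map.mpr ⟨F₀, hΛ F₀ hF₀, rfl⟩

end Summit.ResolutionOfSingularities.ResolutionOfSingularities.Theorems.X3LemmaM

end
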